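import Summits.HubbardSuperconductivity.HubbardLadder.Bounds.TorusDopedN14Rows
import Summits.HubbardSuperconductivity.HubbardLadder.HubbardDopedU16LeverRows
import Summits.HubbardSuperconductivity.HubbardLadder.HubbardMomentumDistributionRows
import HarnessLib

/-!
# R2 rows (device D29 = D25 part 3): the `U′ = 16` lever CLOSED NUMERICALLY — the `secrows1` certificate
# `N14.EU16` as a typed claim node, and the numeric lever rows at (`4 × 4` torus, `N = 14`, `U = 8`, `t' = 0`)

HONEST FRAMING: ladder R1–R4 with certified numbers; no claim on H/H₀.

INPUT (one new node, nothing asserted): the plain-energy SECTOR-mode certificate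
`certs/secrows1/N14.EU16/cert_hub_torus4x4_U16_N14_b4eom.json.gz` (eng-1 kit j105893 `engA-secrows1-N14.EU16`,
LEAD LINE (Q); file sha256 `fa023f9b2703c47ef2e699ee7a9591fff290a0e76f38d9f9f44d77963c2430e5`, canonical `55a1887b9dbe70ef…`;
certsdp/1, `kind = lower_bound`, `model = {geometry torus, t = 1, U = 16, objective total, sector {N: 14, Sz2: null}}`
— the SAME model keys as pub-mbboot's `cert_hub_torus4x4_U8_N14_b4eom_pol` that `Bounds/TorusDopedN14Rows` types as
`Nonempty (TorusSectorCertTT' 4 1 0 8 7 q)`; `claimed.E_cert = −6664478809966285539602583/2⁷⁹ = −11.0254553287…`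
(`−0.6890910`/site outward), reduce twin `−3332239388578900688737271/2⁷⁸`; in-job verifiers A ∧ B ok∧equal; readers of
record + referee replay PENDING at typing time) typed in the house style of `Bounds/TorusDopedN14Rows` §1 as
`Bounds.torusLower_engA_4x4_U16_N14 : Prop := Nonempty (TorusSectorCertTT' 4 1 0 16 7 q)` with the kernel edge
`q ≤ groundEnergyAt (fermionTorusGraph 2 4) 1 16 14` (`TorusSectorCertTT'.groundEnergyAt_ge`, `2 * 7 = 14` by `rfl`).

ROWS (the parametric `U′ = 16` lever rows of `HubbardDopedU16LeverRows` — LEAN FILING REQUEST #148, in tree — with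
`hL := groundEnergyAt_4x4_U16_N14_ge_of_claim h₁₆`; constants by `norm_num`, outward 7 dp for `d`, 4 dp otherwise):
**d ≥ (E₁₆ − u₈)/128 ≥ 0.0065873**, **k ≤ (2u₈ − E₁₆)/16 ≤ −0.7944** (with the D21 floor: `k ∈ [−1.3352, −0.7944]`),
**ḡ ∈ [0.0993, 0.1669]**, **m_loc ≤ 0.8619**, **W_0 ∈ [2.6368, 11.2882]**, **displaced electrons ∈ [0.6592, 5.6441]**,
**nInside ≥ 8.3559**, **h_Γ + n_Q ≤ 2.8221**. AS DESIGNED these are WEAKER than the direct docc sector window of device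
D28 (`HubbardDopedDoubleOccSectorRows`: `d ∈ [0.0223928, 0.0647913]`, `k ≤ −0.9209`): the file records that the lever
of device D25 closes with a POSITIVE (non-vacuous) floor from a plain ENERGY certificate at a second coupling — no
observable SDP — which is the cheaper certificate class (LADDER §R2 (D25); the lead's scoring 2026-08-20T21:44:05Z).
LABEL: CELL SDP energy lower bound at `U′ = 16` used as a lever, `4 × 4` torus, WEAK (ED-able); TYPED CLAIM, UNSIGNED
until the readers of record + the referee's replay + the lead's booking; energy hypothesis `u₈` INHERITED (E2 node).
0 core-h (kernel only).

## References
* X. Han, S. A. Hartnoll, J. Kruthoff, PRL 125 (2020) 041601, §3. [cite: Han2020Bootstrap, §3]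
* T. Koma, H. Tasaki, the supergradient bookkeeping of §1. [cite: KomaTasaki1994, §1]
* E. H. Lieb, M. Loss, *Analysis* (2001), Theorem 1.14 (bathtub). [cite: LiebLoss2001, Theorem 1.14]
* E. H. Lieb, M. Loss, R. J. McCann, J. Math. Phys. 34 (1993) 891, Theorem eqs. (5)-(6). [cite: LiebLossMccann1993, Theorem eqs. (5)-(6)]
* J. E. Hirsch, PRB 31 (1985) 4403, Table II (context only). [cite: HirschPRB1985, Table II]
-/

noncomputable section

namespace Summit.HubbardSuperconductivity.HubbardLadder.Bounds

open Matrix Finset Literature.MathematicalPhysics.QuantumLattice Literature.Probability.LatticeModels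
open scoped ComplexOrder

/-- **CLAIM NODE `N14.EU16`** (eng-1 kit j105893; file `certs/secrows1/N14.EU16/cert_hub_torus4x4_U16_N14_b4eom.json.gz`,
sha256 `fa023f9b2703c47ef2e699ee7a9591fff290a0e76f38d9f9f44d77963c2430e5`; certsdp/1 `lower_bound`, sector mode `{N: 14, Sz2: null}`,
objective `total`, `t = 1`, `U = 16`, `t' = 0`, `4 × 4` torus; `claimed.E_cert = −6664478809966285539602583/2⁷⁹ = −11.0254553287…`;
in-job A ∧ B ok∧equal, readers of record + referee replay pending at typing time): a sector-mode energy certificate with value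
`claimed.E_cert`. TYPED CLAIM, UNSIGNED; WEAK. HONEST FRAMING: ladder R1–R4 with certified numbers; no claim on H/H₀.
[cite: Han2020Bootstrap, §3] -/
@[conjecture] def torusLower_engA_4x4_U16_N14 : Prop :=
  Nonempty (TorusSectorCertTT' 4 1 0 16 7 (-6664478809966285539602583 / 2 ^ 79))

/-- `U = 16`, `N = 14`: exact edge `claimed.E_cert ≤ E_14(4 × 4, t = 1, U = 16)`. TYPED CLAIM, UNSIGNED.
HONEST FRAMING: ladder R1–R4 with certified numbers; no claim on H/H₀. [cite: Han2020Bootstrap, §3] -/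
theorem groundEnergyAt_4x4_U16_N14_ge_of_claim (h : torusLower_engA_4x4_U16_N14) :
    (-6664478809966285539602583 / 2 ^ 79 : ℝ) ≤ groundEnergyAt (fermionTorusGraph 2 4) 1 16 14 := by
  obtain ⟨C⟩ := h
  exact C.groundEnergyAt_ge

/-- `U = 16`, `N = 14`, outward 7-decimal form (lowers rounded DOWN): `−11.0254554 ≤ E_14(16)`. TYPED CLAIM, UNSIGNED.
HONEST FRAMING: ladder R1–R4 with certified numbers; no claim on H/H₀. [cite: Han2020Bootstrap, §3] -/
theorem groundEnergyAt_4x4_U16_N14_ge_decimal (h : torusLower_engA_4x4_U16_N14) :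
    (-11.0254554 : ℝ) ≤ groundEnergyAt (fermionTorusGraph 2 4) 1 16 14 :=
  le_trans (by norm_num) (groundEnergyAt_4x4_U16_N14_ge_of_claim h)

/-- `U = 16`, `N = 14`, per site: `−0.6890910 ≤ E_14(16)/16`. TYPED CLAIM, UNSIGNED.
HONEST FRAMING: ladder R1–R4 with certified numbers; no claim on H/H₀. [cite: Han2020Bootstrap, §3] -/
theorem groundEnergyAt_4x4_U16_N14_perSite_ge_decimal (h : torusLower_engA_4x4_U16_N14) :
    (-0.6890910 : ℝ) ≤ groundEnergyAt (fermionTorusGraph 2 4) 1 16 14 / 16 := by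
  have hE := groundEnergyAt_4x4_U16_N14_ge_of_claim h
  rw [le_div_iff₀ (by norm_num : (0 : ℝ) < 16)]
  exact le_trans (by norm_num) hE

end Summit.HubbardSuperconductivity.HubbardLadder.Bounds

namespace Summit.HubbardSuperconductivity.HubbardLadder

open Matrix Literature.MathematicalPhysics.QuantumLattice Literature.Probability.LatticeModels
open Finset hiding expect
open FermionSpinMoment Bounds
open Literature.MathematicalPhysics.QuantumLattice.FermiSmearing
open scoped ComplexOrder

/-- **R2 row — the `U′ = 16` lever floor on the double occupancy, numeric**: `d ≥ (E₁₆ − u₈)/128 ≥ 0.0065873`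
(exact `509670563210653252095849/2⁸⁶ = 0.00658733…`) for every normalised `N = 14` ground state at `U = 8`.
WEAKER than device D28's direct sector floor `0.0223928` (as designed). TYPED CLAIMS (`N14.EU16` + E2 node), UNSIGNED; WEAK.
HONEST FRAMING: ladder R1–R4 with certified numbers; no claim on H/H₀. [cite: KomaTasaki1994, §1] [cite: Han2020Bootstrap, §3] -/
theorem doubleOcc_four_N14_U8_ge_of_claim16 {ψ : Fock (Orb (FermionTorus 2 4))}
    (hψ : IsGroundState (hamiltonian (fermionTorusGraph 2 4) 1 8) 14 ψ) (hψ1 : star ψ ⬝ᵥ ψ = 1)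
    (h₈ : torusUpper_mbbootE2_4x4_U8_N14) (h₁₆ : torusLower_engA_4x4_U16_N14) :
    (0.0065873 : ℝ) ≤ (expect (∑ x : FermionTorus 2 4, numberOp x 0 * numberOp x 1) ψ).re / 16 :=
  le_trans (by norm_num)
    (doubleOcc_four_N14_U8_ge_of_claim_of_lower16 hψ hψ1 h₈ (groundEnergyAt_4x4_U16_N14_ge_of_claim h₁₆))

/-- **R2 row — kinetic energy per site with the `U′ = 16` lever ceiling**: `k ∈ [−1.3352, −0.7944]`
(ceiling `(2u₈ − E₁₆)/16 = −0.79448…`; floor = the D21 supergradient floor, node `h₄`). D28's direct ceiling is `−0.9209`.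
TYPED CLAIMS, UNSIGNED; WEAK. HONEST FRAMING: ladder R1–R4 with certified numbers; no claim on H/H₀. [cite: KomaTasaki1994, §1] -/
theorem kineticPerSite_four_N14_U8_mem_Icc_of_claim16 {ψ : Fock (Orb (FermionTorus 2 4))}
    (hψ : IsGroundState (hamiltonian (fermionTorusGraph 2 4) 1 8) 14 ψ) (hψ1 : star ψ ⬝ᵥ ψ = 1)
    (h₄ : torusLower_mbboot_4x4_U4_N14) (h₈ : torusUpper_mbbootE2_4x4_U8_N14) (h₁₆ : torusLower_engA_4x4_U16_N14) :
    (expect (hamiltonian (fermionTorusGraph 2 4) 1 0) ψ).re / 16 ∈ Set.Icc (-1.3352 : ℝ) (-0.7944) :=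
  ⟨(kineticPerSite_four_N14_U8_mem_Icc_of_claims hψ hψ1 h₄ h₈).1,
    le_trans (kineticPerSite_four_N14_U8_le_of_lower16 hψ hψ1 h₈ (groundEnergyAt_4x4_U16_N14_ge_of_claim h₁₆))
      (by norm_num)⟩

/-- **R2 row — bond–spin averaged nearest-neighbour hopping amplitude with the `U′ = 16` lever**: `ḡ = −k/8 ∈ [0.0993, 0.1669]`
(D28 direct: `[0.1151, 0.1669]`). TYPED CLAIMS, UNSIGNED; WEAK. HONEST FRAMING: ladder R1–R4 with certified numbers; no claim on H/H₀.
[cite: LiebLossMccann1993, Theorem eqs. (5)-(6)] [cite: KomaTasaki1994, §1] -/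
theorem bondAvg_four_N14_U8_mem_Icc_of_claim16 {ψ : Fock (Orb (FermionTorus 2 4))}
    (hψ : IsGroundState (hamiltonian (fermionTorusGraph 2 4) 1 8) 14 ψ) (hψ1 : star ψ ⬝ᵥ ψ = 1)
    (h₄ : torusLower_mbboot_4x4_U4_N14) (h₈ : torusUpper_mbbootE2_4x4_U8_N14) (h₁₆ : torusLower_engA_4x4_U16_N14) :
    (∑ x : FermionTorus 2 4, ∑ y : FermionTorus 2 4, ∑ σ : Fin 2,
        if (fermionTorusGraph 2 4).Adj x y then expect (creation (orb x σ) * annihilation (orb y σ)) ψ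
        else 0).re / 128 ∈ Set.Icc (0.0993 : ℝ) 0.1669 := by
  have h := bondAvg_four_mem_Icc_of_kinetic (kineticPerSite_four_N14_U8_mem_Icc_of_claim16 hψ hψ1 h₄ h₈ h₁₆)
  exact ⟨le_trans (by norm_num) h.1, le_trans h.2 (by norm_num)⟩

/-- **R2 row — local-moment ceiling with the `U′ = 16` lever**: `m_loc = 7/8 − 2d ≤ 0.8619` (D28 direct: `≤ 0.8302144`).
TYPED CLAIMS, UNSIGNED; WEAK. HONEST FRAMING: ladder R1–R4 with certified numbers; no claim on H/H₀. [cite: HirschPRB1985, Table II] [cite: KomaTasaki1994, §1] -/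
theorem localMoment_four_N14_U8_le_of_claim16 {ψ : Fock (Orb (FermionTorus 2 4))}
    (hψ : IsGroundState (hamiltonian (fermionTorusGraph 2 4) 1 8) 14 ψ) (hψ1 : star ψ ⬝ᵥ ψ = 1)
    (h₈ : torusUpper_mbbootE2_4x4_U8_N14) (h₁₆ : torusLower_engA_4x4_U16_N14) :
    (expect localMomentFour ψ).re / 16 ≤ 0.8619 :=
  le_trans (localMoment_four_N14_U8_le_of_lower16 hψ hψ1 h₈ (groundEnergyAt_4x4_U16_N14_ge_of_claim h₁₆))
    (by norm_num)

/-- **R2 row — Fermi-surface smearing with the `U′ = 16` lever**: `W_0 ∈ [2.6368, 11.2882]` (ceiling `2u₈ − E₁₆ + 24 = 11.28818…`;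
floor = D24's; D28 direct: `≤ 9.2656`). TYPED CLAIMS, UNSIGNED; WEAK. HONEST FRAMING: ladder R1–R4 with certified numbers; no claim on H/H₀.
[cite: LiebLoss2001, Theorem 1.14] [cite: KomaTasaki1994, §1] -/
theorem smearing_four_N14_U8_mem_Icc_of_claim16 {ψ : Fock (Orb (FermionTorus 2 4))}
    (hψ : IsGroundState (hamiltonian (fermionTorusGraph 2 4) 1 8) 14 ψ) (hψ1 : star ψ ⬝ᵥ ψ = 1)
    (h₄ : torusLower_mbboot_4x4_U4_N14) (h₈ : torusUpper_mbbootE2_4x4_U8_N14) (h₁₆ : torusLower_engA_4x4_U16_N14) :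
    smearing 0 ψ ∈ Set.Icc (2.6368 : ℝ) 11.2882 := by
  have hW := smearing_zero_mem_Icc_of_kinetic hψ.1 hψ1 (kineticPerSite_four_N14_U8_mem_Icc_of_claim16 hψ hψ1 h₄ h₈ h₁₆)
  have hW' := smearing_four_N14_U8_le_of_lower16 hψ hψ1 h₈ (groundEnergyAt_4x4_U16_N14_ge_of_claim h₁₆)
  exact ⟨le_trans (by norm_num) hW.1, le_trans hW' (by norm_num)⟩

/-- **R2 rows — occupations with the `U′ = 16` lever** (`N = 14`, `U = 8`): displaced electrons
`holesBelow + nAbove ∈ [0.6592, 5.6441]`, `nInside ≥ 8.3559` of `14`, corner pair `h_Γ + n_Q ≤ 2.8221`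
(D28 direct: `≤ 4.6328` / `≥ 9.3672` / `≤ 2.3164`). TYPED CLAIMS, UNSIGNED; WEAK. HONEST FRAMING: ladder R1–R4 with certified numbers; no claim on H/H₀.
[cite: LiebLoss2001, Theorem 1.14] -/
theorem occupationRows_four_N14_U8_of_claim16 {ψ : Fock (Orb (FermionTorus 2 4))}
    (hψ : IsGroundState (hamiltonian (fermionTorusGraph 2 4) 1 8) 14 ψ) (hψ1 : star ψ ⬝ᵥ ψ = 1)
    (h₄ : torusLower_mbboot_4x4_U4_N14) (h₈ : torusUpper_mbbootE2_4x4_U8_N14) (h₁₆ : torusLower_engA_4x4_U16_N14) :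
    holesBelow ψ + nAbove ψ ∈ Set.Icc (0.6592 : ℝ) 5.6441 ∧ (8.3559 : ℝ) ≤ nInside ψ ∧
      (∑ σ : Fin 2, (1 - occ 0 σ ψ)) + ∑ σ : Fin 2, occ cornerQ σ ψ ≤ 2.8221 := by
  obtain ⟨⟨h1, h2⟩, h3, h4⟩ :=
    occupationRows_of_smearing hψ.1 hψ1 (smearing_four_N14_U8_mem_Icc_of_claim16 hψ hψ1 h₄ h₈ h₁₆)
  norm_num at h1 h2 h3 h4 ⊢
  exact ⟨⟨h1, h2⟩, h3, by linarith⟩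

end Summit.HubbardSuperconductivity.HubbardLadder

end
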